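import Summits.PneNP.PneNP.Theorems.SymmetryBudgetRigidBenchmarkPlainLowerBound
import Summits.PneNP.PneNP.Theorems.SymmetryBudgetRigidBenchmarkConverse

/-!
# Calibration of `SymmetryBudget.RigidBenchmark` (item stmt-PneNP-2149), V: the exact form

Both directions assembled (`SymmetryBudgetRigidBenchmarkPlainLowerBound.lean`: symmetric
colour-refinement canonisation; `SymmetryBudgetRigidBenchmarkConverse.lean`: pendant-path
rigidification):

  `rigidBenchmark_iff_threeColHardIO : RigidBenchmark ↔ ThreeColHardIO`,

where `ThreeColHardIO` (written inline) is the PLAIN circuit lower bound "for every polynomial `q`,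
frequently in `n`, no `tcBasis`-circuit of size `≤ q n` computes 3-colourability of `Gr x` for all
`n × n` matrices `x`". So the route's rigid-instance benchmark — FULL `Sym(Fin m)`-symmetry plus the
promise to colour-refinement-discrete inputs — is exactly the non-symmetric, non-uniform
superpolynomial circuit lower bound for this NP-complete problem in the matrix convention: the two
restrictions buy no logical room in either direction. (With `CHROMATIC ∈ NP` it implies the tree's
conjecture leaf `NPNotSubsetPPoly`, `SymmetryBudgetRigidBenchmarkNPBridge.lean`.)
-/

-- `Summit.PneNP.PneNP.…` duplicates `PneNP` BY DESIGN (single-problem summit, D-0017); the Summits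
-- library sets this option globally (lakefile), repeated here so a standalone `lean check` is warning-free.
set_option linter.dupNamespace false

namespace Summit.PneNP.PneNP.Theorems

open Literature.Computability.Complexity Filter Polynomial
open Summit.PneNP.PneNP.Theses.SymmetryBudget (RigidBenchmark)
open scoped Classical

/-- **Calibration, exact form: `RigidBenchmark` is EQUIVALENT to the plain circuit lower bound for
3-colourability** (`tcBasis`-circuits on matrix inputs, infinitely often superpolynomial). -/
theorem rigidBenchmark_iff_threeColHardIO :
    RigidBenchmark ↔ ∀ q : Polynomial ℕ, ∃ᶠ n in atTop, ¬ ∃ D : Circuit (Fin n × Fin n), D.IsOver tcBasis ∧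
      D.size ≤ q.eval n ∧ ∀ x : Fin n × Fin n → Bool,
        D.eval x = decide ((SimpleGraph.fromRel fun u v => x (u, v) = true :
          SimpleGraph (Fin n)).Colorable 3) :=
  ⟨rigidBenchmark_imp_threeColHardIO, threeColHardIO_imp_rigidBenchmark⟩

/-- Equivalently, with the existential (polynomial-size) phrasing on the right: `RigidBenchmark`
fails iff some polynomial bounds, for all large `n`, a `tcBasis`-circuit computing 3-colourability
of all `n`-vertex graphs. -/
theorem not_rigidBenchmark_iff_eventually_threeColPolySize :
    ¬ RigidBenchmark ↔ ∃ q : Polynomial ℕ, ∀ᶠ n in atTop, ∃ D : Circuit (Fin n × Fin n), D.IsOver tcBasis ∧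
      D.size ≤ q.eval n ∧ ∀ x : Fin n × Fin n → Bool,
        D.eval x = decide ((SimpleGraph.fromRel fun u v => x (u, v) = true :
          SimpleGraph (Fin n)).Colorable 3) := by
  rw [rigidBenchmark_iff_threeColHardIO]
  simp only [not_forall, Filter.not_frequently, not_not]

end Summit.PneNP.PneNP.Theorems
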